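import Mathlib
import Summits.QuantumFields.YangMills.Theorems.RationalShortRootRigidityOfReduce
import Summits.QuantumFields.YangMills.Theorems.RationalShortRootRigidityReduceAssembly

/-!
# `RationalShortRootRigidity` — crux `stmt-QuantumFields-23124` PROVED (Theorem A, rational short-root rigidity)

Closes the route declaration `Summit.QuantumFields.YangMills.Theses.F4SubCurvatureDoor.RationalShortRootRigidity` BY NAME:
the four-step paper proof of planner ym-idea-3 (HOME l15/RATIONAL-SHORT-ROOT-RIGIDITY.md; birth skeleton
l15/RationalShortRootRigidity-birth.lean) is now fully kernel-checked —
Step 1 `stub_reduce` (`RationalShortRootRigidity.stub_reduce'` (p673803), seat frs-p2), Step 2 `stub_planar` (p672469, frs-p2), Step 3 `radial_of_b4Inv_of_planeRotInv`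
(p660676), Step 4 `Alternation.stub_alternation` (p672906), composed by `rationalShortRootRigidity_of_reduce` (p673165).

HONEST LABEL: this is the BC5 rung of crux 23035 `ShortRootRigidity` in the RATIONAL Källén–Lehmann class (Theorem A of the
planner's RESULT 2); the general crux 23035, its split child 23125 `RationalToGeneral`, items 23036/23037/22566, the route
`F4SubCurvatureDoor`, rung R2d/ROT of LADDER-YM and the Yang–Mills mass gap are NOT proved by this.  Free-hands width seat
`ym-line-sfw-p2-w4` g18, `--workitem stmt-QuantumFields-23124`.
-/

set_option autoImplicit false

namespace Summit.QuantumFields.YangMills.Theorems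

/-- **Theorem A (rational short-root rigidity)** — item `stmt-QuantumFields-23124` BY NAME. [folklore] -/
theorem rationalShortRootRigidity_proof :
    Summit.QuantumFields.YangMills.Theses.F4SubCurvatureDoor.RationalShortRootRigidity :=
  RationalShortRootRigidity.rationalShortRootRigidity_of_reduce RationalShortRootRigidity.stub_reduce'

end Summit.QuantumFields.YangMills.Theorems
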